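import Summits.HodgeConjecture.HodgeConjecture.Theses.MilnorKExponential
import Summits.HodgeConjecture.HodgeConjecture.Theorems.MilnorKExponentialSymbolLiftRReduction
import HarnessLib

/-!
# The kernel of `SymbolLiftR` in its weakest folding form: one polarisation, one integration-scaled model

Theorems file of route `MilnorKExponential` of the Hodge summit, crux `SymbolLiftR`
(stmt-HodgeConjecture-18702: every rational class of Hodge type `(q+1,q+1)` on a smooth projective
complex `n`-fold, `q + 1 ≤ n`, is a Milnor SYMBOL class of weight `q + 1` on a symbol-normalised Hodge
model), line `lefschetz-fold`, reshape r2 of the continuation lead c2.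

`Theorems.SymbolLiftR.symbolLiftR_of_primitiveLift` (file `MilnorKExponentialSymbolLiftRReduction`)
reduces the crux to its kernel S5 stated for EVERY hard-Lefschetz datum `Λ` and EVERY Hodge model `A`
with rescaled integration comparison carrying the weight-one cocycles. Two of these generalities are
idle, and this file removes them:

* `hasSymbolCocycle_zero_of_integrationScaled` (file `…WeightOneModel`) shows that EVERY
  integration-scaled model carries the weight-one cocycles of all rational `(1,1)` classes, so the
  weight-one hypothesis of S5 is a theorem (`hasSymbolCocycle_of_primitiveLiftAt'`: the fold on one
  integration-scaled model, kernel ⇒ all weights, with no weight-one hypothesis);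
* the fold runs on any ONE polarisation and any ONE integration-scaled model, so it suffices that for
  each smooth projective `X` of dimension `n ≥ 4` there EXIST `Λ` and an integration-scaled `A` on
  which the `Λ`-primitive rational `(q+2,q+2)` classes, `2(q+2) ≤ n`, have weight-`(q+2)` symbol
  cocycles (`symbolLiftR_of_primitiveLiftExists`), the statement registered as stub
  `stub_primitiveLiftExists` of the line; `primitiveLiftExists_of_primitiveLift` records that r1's S5
  implies it.

What remains open is therefore exactly: LIFT_p for primitive rational `(p,p)` classes with
`2 ≤ p ≤ n/2`, for ONE polarisation and ONE integration-scaled model of each `X` — first case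
`(n,p) = (4,2)`, primitive rational `(2,2)` classes on fourfolds.

References: C. Voisin, *Hodge Theory and Complex Algebraic Geometry I* (2002), Thm. 6.25 (Lefschetz
decomposition), Thm. 7.10 (exponential sequence), Thm. 11.30 (Lefschetz `(1,1)`); R. Bott, L. W. Tu,
*Differential Forms in Algebraic Topology* (1982), §8–9 (Čech–de Rham zig-zag and products).
-/

noncomputable section

-- The mandated namespace repeats `HodgeConjecture` (single-conjunct summit).
set_option linter.dupNamespace false

open scoped Manifold ContDiff

namespace Summit.HodgeConjecture.HodgeConjecture.Theorems.SymbolLiftR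

open Literature.AlgebraicGeometry Literature.AlgebraicGeometry.HodgeTheory
open Literature.Geometry.Kaehler Literature.NumberTheory.Transcendental
open Summit.HodgeConjecture.HodgeConjecture.Theses.MilnorKExponential (SymbolLiftR)

variable {n : ℕ} {X : Motives.SchemeOver ℂ}

/-- **The Lefschetz fold on one integration-scaled model, with no weight-one hypothesis.** Let `A` be
a Hodge model of the smooth projective `n`-fold `X` whose comparison is the `(2πi)^{-k/2}`-rescaled
integration comparison, and `Λ` a hard-Lefschetz datum. If every `Λ`-primitive rational `(q+2,q+2)`
class with `2(q+2) ≤ n` has a weight-`(q+2)` symbol cocycle on `A`, then every rational class of type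
`(q+1,q+1)`, `q + 1 ≤ n`, has a weight-`(q+1)` symbol cocycle on `A`. The weight-one input of
`hasSymbolCocycle_of_primitiveLiftAt` is supplied by `hasSymbolCocycle_zero_of_integrationScaled`
(Lefschetz `(1,1)` in symbol form holds on EVERY integration-scaled model).
[cite: VoisinHodgeI2002, Thm. 6.25, Thm. 7.10 and Thm. 11.30] -/
theorem hasSymbolCocycle_of_primitiveLiftAt' (hX : Motives.IsSmoothProjective n X)
    (Λ : HardLefschetzNFold n X) (A : HodgeModel n X)
    (hA : ∀ (k : ℕ) (y : complexDeRhamCohomology A.model A.carrier k),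
      A.deRham A.carrier k y = ((2 * (Real.pi : ℂ) * Complex.I) ^ (k / 2))⁻¹ •
        (integrationDeRhamIsoFamily A.model).complexify A.carrier k y)
    (h4 : ∀ (q : ℕ), 2 * (q + 2) ≤ n →
      ∀ (c : complexBetti X (2 * (q + 1 + 1))), IsRationalClass c →
        IsOfHodgeType n X (2 * (q + 1 + 1)) (q + 1 + 1) (q + 1 + 1) c →
        (∃ (j t : ℕ) (ht : 2 * (q + 1 + 1) + 2 * j = t),
            2 * (q + 1 + 1) + j = n + 1 ∧ Λ.L j (2 * (q + 1 + 1)) t ht c = 0) →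
          A.HasSymbolCocycle (q + 1) c) :
    ∀ q : ℕ, q + 1 ≤ n → ∀ c : complexBetti X (2 * (q + 1)), IsRationalClass c →
      IsOfHodgeType n X (2 * (q + 1)) (q + 1) (q + 1) c → A.HasSymbolCocycle q c :=
  hasSymbolCocycle_of_primitiveLiftAt hX Λ A hA
    (fun c hc h11 ↦ hasSymbolCocycle_zero_of_integrationScaled hX A hA c hc h11) h4

/-- **`SymbolLiftR` follows from its kernel in the weakest folding form** (stub
`stub_primitiveLiftExists` of line `lefschetz-fold`, reshape r2, stated unfolded): if for every smooth
projective `X` of dimension `n ≥ 4` there exist a hard-Lefschetz datum `Λ` and a Hodge model `A` with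
rescaled integration comparison on which every `Λ`-primitive rational `(q+2,q+2)` class with
`2(q+2) ≤ n` has a weight-`(q+2)` symbol cocycle, then the crux `SymbolLiftR` holds. For `n ≤ 3` the
kernel is never met and the polarisation and the model come from the tree
(`nonempty_hardLefschetzNFold_holds`, `stub_weightOneModel`); in all dimensions the normalisation is
`stub_powerNormalisation` and the cocycle is `hasSymbolCocycle_of_primitiveLiftAt'`; the regrouping
between the named vocabulary and the inlined text of the route decl is definitional. First open
instance of the hypothesis: `(n, p) = (4, 2)`. [cite: VoisinHodgeI2002, Thm. 6.25 and Thm. 11.30] -/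
theorem symbolLiftR_of_primitiveLiftExists
    (h5 : ∀ ⦃n : ℕ⦄ ⦃X : Motives.SchemeOver ℂ⦄, Motives.IsSmoothProjective n X → 4 ≤ n →
      ∃ (Λ : HardLefschetzNFold n X) (A : HodgeModel n X),
        (∀ (k : ℕ) (y : complexDeRhamCohomology A.model A.carrier k),
          A.deRham A.carrier k y = ((2 * (Real.pi : ℂ) * Complex.I) ^ (k / 2))⁻¹ •
            (integrationDeRhamIsoFamily A.model).complexify A.carrier k y) ∧
        ∀ (q : ℕ), 2 * (q + 2) ≤ n →
          ∀ (c : complexBetti X (2 * (q + 1 + 1))), IsRationalClass c →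
            IsOfHodgeType n X (2 * (q + 1 + 1)) (q + 1 + 1) (q + 1 + 1) c →
            (∃ (j t : ℕ) (ht : 2 * (q + 1 + 1) + 2 * j = t),
                2 * (q + 1 + 1) + j = n + 1 ∧ Λ.L j (2 * (q + 1 + 1)) t ht c = 0) →
              A.HasSymbolCocycle (q + 1) c) :
    SymbolLiftR := by
  intro n X hX q hq c hc hpp
  -- one polarisation and one integration-scaled model carrying the primitive lifts
  obtain ⟨Λ, A, hA, h4⟩ : ∃ (Λ : HardLefschetzNFold n X) (A : HodgeModel n X),
      (∀ (k : ℕ) (y : complexDeRhamCohomology A.model A.carrier k),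
        A.deRham A.carrier k y = ((2 * (Real.pi : ℂ) * Complex.I) ^ (k / 2))⁻¹ •
          (integrationDeRhamIsoFamily A.model).complexify A.carrier k y) ∧
        ∀ (q : ℕ), 2 * (q + 2) ≤ n → ∀ (c : complexBetti X (2 * (q + 1 + 1))), IsRationalClass c →
          IsOfHodgeType n X (2 * (q + 1 + 1)) (q + 1 + 1) (q + 1 + 1) c →
          (∃ (j t : ℕ) (ht : 2 * (q + 1 + 1) + 2 * j = t),
              2 * (q + 1 + 1) + j = n + 1 ∧ Λ.L j (2 * (q + 1 + 1)) t ht c = 0) →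
            A.HasSymbolCocycle (q + 1) c := by
    by_cases h4n : 4 ≤ n
    · exact h5 hX h4n
    · obtain ⟨Λ⟩ := nonempty_hardLefschetzNFold_holds n X hX
      obtain ⟨A, hA, -⟩ := stub_weightOneModel hX (by omega)
      exact ⟨Λ, A, hA, fun q' hq' ↦ absurd hq' (by omega)⟩
  have hN : A.IsSymbolNormalized q := stub_powerNormalisation hX A hA q hq
  have hS : A.HasSymbolCocycle q c := hasSymbolCocycle_of_primitiveLiftAt' hX Λ A hA h4 q hq c hc hpp
  refine ⟨A, ?_, ?_⟩
  · obtain ⟨ι, hι, L, θ₀, c₀, hT, hr, hne, hde⟩ := hN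
    exact ⟨ι, hι, L, θ₀, c₀, hT, hr, hne, hde⟩
  · obtain ⟨ι, hι, U, hU, hcov, σ, hσ, θ, m, hm, hT, hde⟩ := hS
    exact ⟨ι, hι, U, hU, hcov, σ, hσ.1, hσ.2, θ, m, hm, hT, hde⟩

/-- **The reshape only weakens the obligation**: the kernel S5 of reshape r1 (`∀ Λ ∀ A` integration-
scaled carrying the weight-one cocycles ⇒ primitive lifts) implies the kernel S5∃ of reshape r2
(`∃ Λ ∃ A`), by the tree's hard-Lefschetz datum `nonempty_hardLefschetzNFold_holds` and the weight-one
model `stub_weightOneModel`. [cite: VoisinHodgeI2002, Thm. 6.25 and Thm. 11.30] -/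
theorem primitiveLiftExists_of_primitiveLift
    (h4 : ∀ ⦃n : ℕ⦄ ⦃X : Motives.SchemeOver ℂ⦄, Motives.IsSmoothProjective n X →
      ∀ (Λ : HardLefschetzNFold n X) (A : HodgeModel n X),
        (∀ (k : ℕ) (y : complexDeRhamCohomology A.model A.carrier k),
          A.deRham A.carrier k y = ((2 * (Real.pi : ℂ) * Complex.I) ^ (k / 2))⁻¹ •
            (integrationDeRhamIsoFamily A.model).complexify A.carrier k y) →
        (∀ c : complexBetti X (2 * (0 + 1)), IsRationalClass c →
          IsOfHodgeType n X (2 * (0 + 1)) (0 + 1) (0 + 1) c → A.HasSymbolCocycle 0 c) →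
        ∀ (q : ℕ), 2 * (q + 2) ≤ n →
          ∀ (c : complexBetti X (2 * (q + 1 + 1))), IsRationalClass c →
            IsOfHodgeType n X (2 * (q + 1 + 1)) (q + 1 + 1) (q + 1 + 1) c →
            (∃ (j t : ℕ) (ht : 2 * (q + 1 + 1) + 2 * j = t),
                2 * (q + 1 + 1) + j = n + 1 ∧ Λ.L j (2 * (q + 1 + 1)) t ht c = 0) →
              A.HasSymbolCocycle (q + 1) c) :
    ∀ ⦃n : ℕ⦄ ⦃X : Motives.SchemeOver ℂ⦄, Motives.IsSmoothProjective n X → 4 ≤ n →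
      ∃ (Λ : HardLefschetzNFold n X) (A : HodgeModel n X),
        (∀ (k : ℕ) (y : complexDeRhamCohomology A.model A.carrier k),
          A.deRham A.carrier k y = ((2 * (Real.pi : ℂ) * Complex.I) ^ (k / 2))⁻¹ •
            (integrationDeRhamIsoFamily A.model).complexify A.carrier k y) ∧
        ∀ (q : ℕ), 2 * (q + 2) ≤ n →
          ∀ (c : complexBetti X (2 * (q + 1 + 1))), IsRationalClass c →
            IsOfHodgeType n X (2 * (q + 1 + 1)) (q + 1 + 1) (q + 1 + 1) c →
            (∃ (j t : ℕ) (ht : 2 * (q + 1 + 1) + 2 * j = t),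
                2 * (q + 1 + 1) + j = n + 1 ∧ Λ.L j (2 * (q + 1 + 1)) t ht c = 0) →
              A.HasSymbolCocycle (q + 1) c := by
  intro n X hX _
  obtain ⟨Λ⟩ := nonempty_hardLefschetzNFold_holds n X hX
  obtain ⟨A, hA, hone⟩ := stub_weightOneModel hX (by omega)
  exact ⟨Λ, A, hA, h4 hX Λ A hA hone⟩

/-- STUB-EDGE `stub_symbolLiftR_of_primitiveLiftExists` (reduction edge of item stmt-HodgeConjecture-18702,
reshape r2, anchoring this file for `--supports`): the registered open kernel `stub_primitiveLiftExists`
of line `lefschetz-fold`, stated unfolded, implies the crux `SymbolLiftR` —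
`symbolLiftR_of_primitiveLiftExists`. [cite: VoisinHodgeI2002, Thm. 6.25 and Thm. 11.30] -/
theorem stub_symbolLiftR_of_primitiveLiftExists : (∀ ⦃n : ℕ⦄ ⦃X : Motives.SchemeOver ℂ⦄, Motives.IsSmoothProjective n X → 4 ≤ n → ∃ (Λ : HardLefschetzNFold n X) (A : HodgeModel n X), (∀ (k : ℕ) (y : complexDeRhamCohomology A.model A.carrier k), A.deRham A.carrier k y = ((2 * (Real.pi : ℂ) * Complex.I) ^ (k / 2))⁻¹ • (integrationDeRhamIsoFamily A.model).complexify A.carrier k y) ∧ ∀ (q : ℕ), 2 * (q + 2) ≤ n → ∀ (c : complexBetti X (2 * (q + 1 + 1))), IsRationalClass c → IsOfHodgeType n X (2 * (q + 1 + 1)) (q + 1 + 1) (q + 1 + 1) c → (∃ (j t : ℕ) (ht : 2 * (q + 1 + 1) + 2 * j = t), 2 * (q + 1 + 1) + j = n + 1 ∧ Λ.L j (2 * (q + 1 + 1)) t ht c = 0) → A.HasSymbolCocycle (q + 1) c) → Summit.HodgeConjecture.HodgeConjecture.Theses.MilnorKExponential.SymbolLiftR :=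
  fun h5 ↦ symbolLiftR_of_primitiveLiftExists h5

end Summit.HodgeConjecture.HodgeConjecture.Theorems.SymbolLiftR

end
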